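import Summits.CriticalPhenomena.PercolationContinuityZ3.Theorems.FK.Transplant.FHSlabWidthMono
import Mathlib.Order.LiminfLimsup
import HarnessLib

/-!
# FRONTIER TRANSPLANT, binder 1 (FH) calibration leaf V (b) — Bodineau's `liminf_N` form of free slab percolation IS the
# barrier note's `inf_N` form: `Π(p, L) ⟺ 0 < liminf_N inf_{x ∈ S(L,N)} φ⁰_{S(L,N),p,q}(0 ↔ x)` (`0 < p ≤ 1`, `q ≥ 1`), so
# Bodineau's slab threshold (2005, §2.2 eq. (2.3)) is FBN-01's `p̂_c(q, L)` — the named fact's "identification informal" made formal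

Support file (`--supports stmt-CriticalPhenomena-4575`, helper) of the FRONTIER TRANSPLANT sub-cell
(`fk-continuity/transplant/`, seat `prim-bschramm-fkt-p2`); builds on p205010 (kernel theorem, internal audit signed;
external expert review pending). No definitions, no named facts, no sorries; standard axioms.
Registered R68 (cell INBOX l.5035, 2026-08-23); registry row T1v; lead label T1v-B (fkt-lead L32, l.5006).

HONEST FRAMING (page 1, cell rule). The transplant's theorem of record `ufsc0_of_freeBoundaryHypothesis_r3`
(p248245, « 2 / 0 ☑ ») is CONDITIONAL on FH AND on TP_FK = `KNFreeTargetHittable d q p`, both OPEN at the same `p`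
for `q > 1` near `p_c(q)` (⇔ GRC Conj. (5.103) via K1; barrier note
`Literature.Barriers.CriticalPhenomena.SamePFreeBoundaryCriteria`, FBN-01, cited first); the transplant is a typed
reduction, not a proof of FK continuity. THIS FILE is finite-volume measure theory for the free slab laws of FBN-01;
`FH`, `KNFreeTargetHittable`, `UFSC0` do not occur in it; Conjecture (5.103) is asserted for NO `q`; nothing at
`p ↓ p_c(q)`; `_r3`, n_open = 2, BINDER-OWNERS, FO-19 NO-GO unchanged. FBN-01 vendors the named fact
`Bodineau2005_slabThreshold` with Severo's `inf_N` (scope caveat (c): "Bodineau's `liminf_N` versus the vendored `inf_N`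
(equal thresholds: for fixed `L` and `p ∈ (0,1]` all terms are positive) … informal identifications"); here that
identification is a kernel theorem.

## What is proved (`q ≥ 1`)

* `fkSlabConnectivity_pos (hp : p ∈ Ioc 0 1)` — every free slab connectivity is POSITIVE: `φ⁰_{S(L,N),p,q}(0 ↔ x) ≥ p̃^{#E}`,
  `p̃ = p/(p + q(1-p))`, `E` the lattice edges of the coordinate box spanned by `0` and `x` ((3.23) against `P_p̃` and the
  all-open box);
* **`fkSlabPercolation_iff_eventually`** — `Π(p, L) ⟺ ∃ α > 0, ∀ᶠ N, ∀ x ∈ S(L,N), α < φ⁰(0 ↔ x)` (`0 < p ≤ 1`): finitely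
  many widths `N < N₀` are absorbed into the margin by positivity;
* **`fkSlabPercolation_iff_liminf_pos`** — `Π(p, L) ⟺ 0 < liminf_N (⨅_{x ∈ S(L,N)} φ⁰_{S(L,N),p,q}(0 ↔ x))` (`0 < p ≤ 1`);
* **`fkSlabCriticalProbAt_eq_sInf_liminf (hd : 1 ≤ d)`** — `p̂_c(q, L) = inf{p ∈ (0,1] : 0 < liminf_N inf_x φ⁰(0 ↔ x)}`,
  Bodineau's (2.3) read over `p ∈ (0, 1]` (his `L ↦ p̂_c(L)` non-increasing with limit `p̂_c` is T1q-B's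
  `fkSlabCriticalProbAt_antitone` / `tendsto_fkSlabCriticalProbAt`), and `fkSlabCriticalProbAt_eq_sInf_Ioc`.

## References

* T. Bodineau, *Slab percolation for the Ising model*, PTRF 132 (2005) 83–118, §2.2 eq. (2.3) (p̂_c(L) with liminf_N),
  Thm. 2.1 [Bodineau2005].
* F. Severo, *Slab percolation for the Ising model revisited*, ECP 29 (2024), §1 (p̂_c(q, d) with inf_N) [Severo2024].
* G. Grimmett, *The Random-Cluster Model*, Springer 2006, §5.7 (Π(p, L), (5.102)); Thm. (3.21) eq. (3.23) [Grimmett2006].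
-/

noncomputable section

open MeasureTheory Filter

namespace Summit.CriticalPhenomena.PercolationContinuityZ3.Theorems.FK

open Literature.Probability.Percolation Literature.Probability.LatticeModels SimpleGraph Finset
open Literature.Barriers.CriticalPhenomena

variable {d : ℕ}

/-! ### Positivity of the free slab connectivities -/

/-- **Every free slab connectivity is positive** (`0 < p ≤ 1`, `q ≥ 1`): `0 < φ⁰_{S(L,N),p,q}(0 ↔ x)` — by (3.23) it is at
least the `P_p̃`-probability (`p̃ = p/(p + q(1-p)) > 0`) that every lattice edge of the coordinate box spanned by `0` and
`x` (a sub-box of `S(L, N)`) is open, which is `p̃^{#edges} > 0`. [cite: Grimmett2006, Thm. (3.21) eq. (3.23); §5.7 (ψ^{L,n}_{p,q})] -/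
theorem fkSlabConnectivity_pos {p q : ℝ} (hp : p ∈ Set.Ioc (0 : ℝ) 1) (hq : 1 ≤ q) (L N : ℕ) (x : FKSlabV d L N) :
    0 < fkSlabConnectivity d p q L N x := by
  have hp' : p ∈ Set.Icc (0 : ℝ) 1 := ⟨hp.1.le, hp.2⟩
  set P : unitInterval := ⟨p, hp'⟩ with hP
  set pt : unitInterval := ⟨(P : ℝ) / (P + q * (1 - P)), ratio_mem_Icc P.2 hq⟩ with hpt
  have hpt0 : 0 < (pt : ℝ) := by
    show 0 < (P : ℝ) / (P + q * (1 - P))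
    exact div_pos hp.1 (by linarith [one_le_ratio_den P.2 hq])
  -- the coordinate box spanned by `0` and `x`, inside the slab box
  set B : Finset (Site d) := Finset.Icc ((0 : Site d) ⊓ (x : Site d)) (0 ⊔ (x : Site d)) with hB
  have hBS : B ⊆ fkSlab d L N := by
    rw [SlabHD.fkSlab_eq_Icc d L N]
    exact HDHit.Icc_inf_sup_subset (by rw [← SlabHD.fkSlab_eq_Icc d L N]; exact zero_mem_fkSlab d L N)
      (by rw [← SlabHD.fkSlab_eq_Icc d L N]; exact x.2)
  set E : Finset (Sym2 (Site d)) := edgesIn (zdGraph d) B with hE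
  have hEedge : (↑E : Set (Sym2 (Site d))) ⊆ (zdGraph d).edgeSet := fun e he => (mem_edgesIn_iff.1 (mem_coe.1 he)).1
  calc (0 : ℝ) < (pt : ℝ) ^ E.card := pow_pos hpt0 _
    _ = (bondPercolation (zdGraph d) pt).real {ω | (↑E : Set (Sym2 (Site d))) ⊆ ω} :=
        (bondPercolation_real_setOf_subset _ pt E hEedge).symm
    _ ≤ (bondPercolation (zdGraph d) pt).real (openConnIn (↑(fkSlab d L N) : Set (Site d)) 0 x) := by
        haveI : IsProbabilityMeasure (bondPercolation (zdGraph d) pt) := inferInstance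
        exact measureReal_mono (fun ω hω => mem_openConnIn_of_edgesIn_Icc_subset (coe_subset.2 hBS) hω)
          (measure_ne_top _ _)
    _ = fkSlabConnectivity d pt 1 L N x := (fkSlabConnectivity_one_right_eq pt L N x).symm
    _ ≤ fkSlabConnectivity d p q L N x := fkSlabConnectivity_ratio_one_le hp' hq L N x

/-- The free slab connectivities are at most `1`. [cite: Grimmett2006, §5.7 (ψ^{L,n}_{p,q})] -/
theorem fkSlabConnectivity_le_one {p q : ℝ} (hp : p ∈ Set.Icc (0 : ℝ) 1) (hq : 0 < q) (L N : ℕ) (x : FKSlabV d L N) :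
    fkSlabConnectivity d p q L N x ≤ 1 := by
  haveI := isProbabilityMeasure_rcMeasure (finsetGraph (zdGraph d) (fkSlab d L N)) hp hq (∅ : Set (FKSlabV d L N))
  exact measureReal_le_one

/-! ### The `liminf_N` (Bodineau) and `inf_N` (Severo, FBN-01) forms of `Π(p, L)` agree -/

/-- **`Π(p, L)` in EVENTUAL form**: for `0 < p ≤ 1`, `q ≥ 1`, `Π(p, L)` holds iff some `α > 0` bounds the connectivities
`φ⁰_{S(L,N),p,q}(0 ↔ x)` from below for all SUFFICIENTLY LARGE `N` (the finitely many small widths are absorbed into the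
margin, every connectivity being positive, `fkSlabConnectivity_pos`). [cite: Grimmett2006, §5.7 (the property Π(p, L))] [cite: Bodineau2005, §2.2 eq. (2.3)] -/
theorem fkSlabPercolation_iff_eventually {p q : ℝ} (hp : p ∈ Set.Ioc (0 : ℝ) 1) (hq : 1 ≤ q) (L : ℕ) :
    FKSlabPercolation d p q L ↔
      ∃ α : ℝ, 0 < α ∧ ∀ᶠ N in atTop, ∀ x : FKSlabV d L N, α < fkSlabConnectivity d p q L N x := by
  constructor
  · rintro ⟨α, hα, h⟩
    exact ⟨α, hα, Eventually.of_forall h⟩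
  · rintro ⟨α, hα, h⟩
    obtain ⟨N₀, hN₀⟩ := eventually_atTop.1 h
    -- a positive lower bound of the connectivities at each fixed width
    have hβ : ∀ N : ℕ, ∃ β : ℝ, 0 < β ∧ ∀ x : FKSlabV d L N, β < fkSlabConnectivity d p q L N x := by
      intro N
      haveI : Nonempty (FKSlabV d L N) := ⟨fkSlabCentre d L N⟩
      obtain ⟨x₀, hx₀⟩ := Finite.exists_min fun x : FKSlabV d L N => fkSlabConnectivity d p q L N x
      exact ⟨fkSlabConnectivity d p q L N x₀ / 2, half_pos (fkSlabConnectivity_pos hp hq L N x₀),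
        fun x => (half_lt_self (fkSlabConnectivity_pos hp hq L N x₀)).trans_le (hx₀ x)⟩
    choose β hβ0 hβlt using hβ
    -- the margin: the least of `α` and the `β N`, `N < N₀`
    set S : Finset ℝ := insert α ((Finset.range N₀).image β) with hS
    have hSne : S.Nonempty := ⟨α, mem_insert_self _ _⟩
    refine ⟨S.min' hSne, (Finset.lt_min'_iff S hSne).2 fun y hy => ?_, fun N x => ?_⟩
    · rcases mem_insert.1 hy with rfl | hy
      · exact hα
      · obtain ⟨N, -, rfl⟩ := mem_image.1 hy
        exact hβ0 N
    · rcases lt_or_ge N N₀ with hN | hN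
      · exact (Finset.min'_le S (β N) (mem_insert_of_mem (mem_image_of_mem β (mem_range.2 hN)))).trans_lt
          (hβlt N x)
      · exact (Finset.min'_le S α (mem_insert_self _ _)).trans_lt (hN₀ N hN x)

/-- **Bodineau's form of `Π(p, L)` is the barrier note's**: for `0 < p ≤ 1`, `q ≥ 1`,
`Π(p, L) ⟺ 0 < liminf_N inf_{x ∈ S(L,N)} φ⁰_{S(L,N),p,q}(0 ↔ x)` (Bodineau 2005, (2.3), defines `p̂_c(L)` through the
right-hand side; Severo 2024 and FBN-01 through `inf_N`). [cite: Bodineau2005, §2.2 eq. (2.3)] [cite: Severo2024, §1 (definition of p̂_c)] -/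
theorem fkSlabPercolation_iff_liminf_pos {p q : ℝ} (hp : p ∈ Set.Ioc (0 : ℝ) 1) (hq : 1 ≤ q) (L : ℕ) :
    FKSlabPercolation d p q L ↔
      0 < liminf (fun N => ⨅ x : FKSlabV d L N, fkSlabConnectivity d p q L N x) atTop := by
  have hp' : p ∈ Set.Icc (0 : ℝ) 1 := ⟨hp.1.le, hp.2⟩
  have hq0 : 0 < q := one_pos.trans_le hq
  haveI : ∀ N, Nonempty (FKSlabV d L N) := fun N => ⟨fkSlabCentre d L N⟩
  -- the sequence `N ↦ inf_x φ⁰(0 ↔ x)` takes values in `[0, 1]`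
  have hle : ∀ N, (⨅ x : FKSlabV d L N, fkSlabConnectivity d p q L N x) ≤ 1 := fun N =>
    (ciInf_le (Set.finite_range _).bddBelow (fkSlabCentre d L N)).trans (fkSlabConnectivity_le_one hp' hq0 L N _)
  have hge : ∀ N, 0 ≤ ⨅ x : FKSlabV d L N, fkSlabConnectivity d p q L N x := fun N =>
    le_ciInf fun x => (fkSlabConnectivity_pos hp hq L N x).le
  rw [fkSlabPercolation_iff_eventually hp hq L]
  constructor
  · rintro ⟨α, hα, h⟩
    refine hα.trans_le (le_liminf_of_le (isCoboundedUnder_ge_of_le atTop hle) (h.mono fun N hN => ?_))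
    exact le_ciInf fun x => (hN x).le
  · intro h
    obtain ⟨b, hb0, hb⟩ := exists_between h
    have hev := eventually_lt_of_lt_liminf hb ⟨0, eventually_map.2 (Eventually.of_forall hge)⟩
    exact ⟨b, hb0, hev.mono fun N hN x => hN.trans_le (ciInf_le (Set.finite_range _).bddBelow x)⟩

/-! ### Bodineau's slab threshold is `p̂_c(q, L)` -/

/-- The set of (5.102) may be read over `p ∈ (0, 1]`: `p̂_c(q, L) = inf{p ∈ (0,1] : Π(p, L)}` (`d ≥ 1`, `q ≥ 1`; `Π` fails
at `p = 0`, `pos_of_fkSlabPercolation`-style: `Π(p, L)` puts `p ≥ p_c(q) > 0`). [cite: Grimmett2006, §5.7 eq. (5.102)] -/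
theorem fkSlabCriticalProbAt_eq_sInf_Ioc (hd : 1 ≤ d) {q : ℝ} (hq : 1 ≤ q) (L : ℕ) :
    fkSlabCriticalProbAt d q L = sInf {p : ℝ | p ∈ Set.Ioc (0 : ℝ) 1 ∧ FKSlabPercolation d p q L} := by
  unfold fkSlabCriticalProbAt
  congr 1
  ext p
  simp only [Set.mem_setOf_eq, Set.mem_Icc, Set.mem_Ioc]
  constructor
  · rintro ⟨hp, h⟩
    exact ⟨⟨(rcCriticalProb_pos hd hq).trans_le (rcCriticalProb_le_of_fkSlabPercolation hd hq hp h), hp.2⟩, h⟩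
  · rintro ⟨hp, h⟩
    exact ⟨⟨hp.1.le, hp.2⟩, h⟩

/-- **Bodineau's slab threshold (2005, eq. (2.3)) IS the barrier note's `p̂_c(q, L)`** (`d ≥ 1`, `q ≥ 1`):
`p̂_c(q, L) = inf{p ∈ (0,1] : 0 < liminf_N inf_{x ∈ S(L,N)} φ⁰_{S(L,N),p,q}(0 ↔ x)}` — FBN-01's "identification informal" of
the named fact `Bodineau2005_slabThreshold` with Bodineau's own statement, made formal (his `p̂_c = lim_L p̂_c(L)` is then
FBN-01's `fkSlabCriticalProb`, tree `tendsto_fkSlabCriticalProbAt`). [cite: Bodineau2005, §2.2 eq. (2.3), Thm. 2.1] [cite: Severo2024, §1 (definition of p̂_c), Thm. 1.1] -/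
theorem fkSlabCriticalProbAt_eq_sInf_liminf (hd : 1 ≤ d) {q : ℝ} (hq : 1 ≤ q) (L : ℕ) :
    fkSlabCriticalProbAt d q L = sInf {p : ℝ | p ∈ Set.Ioc (0 : ℝ) 1 ∧
      0 < liminf (fun N => ⨅ x : FKSlabV d L N, fkSlabConnectivity d p q L N x) atTop} := by
  rw [fkSlabCriticalProbAt_eq_sInf_Ioc hd hq L]
  congr 1
  ext p
  simp only [Set.mem_setOf_eq]
  exact and_congr_right fun hp => fkSlabPercolation_iff_liminf_pos hp hq L

end Summit.CriticalPhenomena.PercolationContinuityZ3.Theorems.FK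

end
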